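import Mathlib
import HarnessLib

/-!
# `NPointIsotropy` — angular Paley–Wiener on `ℂ/(π/2)ℤ` (support for stmt-QuantumFields-11686)

Support file for crux `stmt-QuantumFields-11686` (`PencilRigidity.NPointIsotropy`), line
`complex-rotation-bandlimit`, stub `stub_bandlimit`. Pure complex analysis over Mathlib, no
project vocabulary and no named facts:

an ENTIRE function `Φ : ℂ → ℂ` with `Φ (z + π/2) = Φ z` and `‖Φ z‖ ≤ C e^{N |Im z|}` is, on the
real axis, a finite trigonometric polynomial `Φ θ = ∑_{|k| ≤ M} c_k e^{4ikθ}` whose harmonics with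
`4|k| > N` vanish; for every `K` with `N < 4(K+1)` it reads `Φ θ = ∑_{|k| ≤ K} c_k e^{4ikθ}`.
* `stub_bandlimit` — the explicit-degree form, stated byte-for-byte as registered for the crux
  (skeleton `Cruxes/NPointIsotropy/Lines/complex-rotation-bandlimit.lean`, gen 2, sha `b19344cfca0f`);
* `bandlimit_exists_degree` — the existential-degree form WITH the vanishing clause
  (`∃ M c, … ∧ ∀ k, N < 4|k| → c k = 0`), the shape of the line lead's reshape r1 of that skeleton;
* `bandlimit_main` — the master statement both are read off from (one coefficient sequence, the
  vanishing clause, and the expansion for every admissible cut-off `K`).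

Route.  The restriction `Φ|ℝ` is continuous and `π/2`-periodic, so it lifts
(`Function.Periodic.lift`) to `C(AddCircle (π/2), ℂ)`, whose Fourier monomials are
`fourier k θ = e^{4ikθ}` (`fourier_quarterCircle_apply`) and whose `k`-th coefficient is
`(2/π) ∫₀^{π/2} e^{-4ikx} Φ x dx` (Mathlib's `fourierCoeff_eq_intervalIntegral`).  By Cauchy–Goursat
on the rectangle `[0, π/2] × [0, y]` (Mathlib's `Complex.integral_boundary_rect_eq_zero_of_differentiableOn`;
the vertical sides cancel because `z ↦ e^{4imz} Φ z` is again `π/2`-periodic, `twist_periodic`) the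
coefficient integral may be computed on any horizontal line `Im z = y`
(`integral_horizontal_eq_of_periodic`); at height `y = ±s` it is bounded by
`(π/2) C e^{(N - 4|k|) s} → 0` (`s → ∞`), so the coefficient vanishes whenever `4|k| > N`
(`integral_twist_eq_zero`).  The coefficients are then supported in `|k| ≤ K` for every `K` with
`N < 4(K+1)` (e.g. `K = ⌈N/4⌉₊` or `⌊N/4⌋₊`), hence summable, and Mathlib's
`has_pointwise_sum_fourier_series_of_summable` gives the pointwise expansion, which collapses to a
finite sum (`hasSum_sum_of_ne_finset_zero` + uniqueness of sums).  Nothing here is specific to the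
crux: no Schwinger functions, no named facts, axioms `propext/Classical.choice/Quot.sound` only.

References: R. P. Boas, *Entire Functions* (1954), §6.10 (Paley–Wiener, periodic case = Laurent
coefficients in `q = e^{4iz}`); E. C. Titchmarsh, *The Theory of Functions*, 2nd ed. (1939), §2.5.
[folklore]
-/

noncomputable section

open scoped BigOperators
open Complex MeasureTheory Set Filter Topology intervalIntegral

namespace Summit.QuantumFields.YangMills.Theorems.NPointIsotropy.ComplexRotationBandlimit

/-! ## The Fourier monomials of the circle of length `π/2` -/

/-- On the circle `ℝ/(π/2)ℤ` the `k`-th Fourier monomial is `θ ↦ e^{4ikθ}`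
(`2πikθ/(π/2) = 4ikθ`). [folklore] -/
theorem fourier_quarterCircle_apply (k : ℤ) (θ : ℝ) :
    fourier k ((θ : ℝ) : AddCircle (Real.pi / 2)) =
      Complex.exp (4 * (k : ℂ) * (θ : ℂ) * Complex.I) := by
  rw [fourier_coe_apply]
  congr 1
  have hπ : (Real.pi : ℂ) ≠ 0 := Complex.ofReal_ne_zero.mpr Real.pi_ne_zero
  push_cast
  field_simp
  ring

/-! ## Contour shift for `π/2`-periodic entire functions -/

/-- The twisted function `z ↦ e^{4imz} Φ z` inherits the period `π/2` from `Φ`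
(`e^{4im·π/2} = e^{2πim} = 1` for `m ∈ ℤ`). [folklore] -/
theorem twist_periodic {Φ : ℂ → ℂ} (hper : ∀ z : ℂ, Φ (z + (Real.pi / 2 : ℝ)) = Φ z) (m : ℤ)
    (z : ℂ) :
    Complex.exp (4 * (m : ℂ) * (z + (Real.pi / 2 : ℝ)) * Complex.I) * Φ (z + (Real.pi / 2 : ℝ)) =
      Complex.exp (4 * (m : ℂ) * z * Complex.I) * Φ z := by
  rw [hper]
  congr 1
  have : 4 * (m : ℂ) * (z + (Real.pi / 2 : ℝ)) * Complex.I =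
      4 * (m : ℂ) * z * Complex.I + m * (2 * Real.pi * Complex.I) := by
    push_cast
    ring
  rw [this, Complex.exp_add, Complex.exp_int_mul_two_pi_mul_I, mul_one]

/-- **Contour shift.** For an entire `F` with period `π/2`, the integral of `F` over the
horizontal segment `[0, π/2] + iy` does not depend on the height `y` (Cauchy–Goursat on the
rectangle `[0, π/2] × [0, y]`, Mathlib's `Complex.integral_boundary_rect_eq_zero_of_differentiableOn`;
the two vertical sides cancel by periodicity). [folklore] -/
theorem integral_horizontal_eq_of_periodic {F : ℂ → ℂ} (hF : Differentiable ℂ F)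
    (hper : ∀ z : ℂ, F (z + (Real.pi / 2 : ℝ)) = F z) (y : ℝ) :
    ∫ x in (0 : ℝ)..Real.pi / 2, F (x + y * I) = ∫ x in (0 : ℝ)..Real.pi / 2, F x := by
  have h := Complex.integral_boundary_rect_eq_zero_of_differentiableOn F 0
    ((Real.pi / 2 : ℝ) + y * I) hF.differentiableOn
  have hre : (((Real.pi / 2 : ℝ) : ℂ) + y * I).re = Real.pi / 2 := by simp
  have him : (((Real.pi / 2 : ℝ) : ℂ) + y * I).im = y := by simp
  rw [Complex.zero_re, Complex.zero_im, hre, him] at h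
  -- the vertical sides cancel
  have hvert : (∫ t : ℝ in (0 : ℝ)..y, F (((Real.pi / 2 : ℝ) : ℂ) + t * I)) =
      ∫ t : ℝ in (0 : ℝ)..y, F (((0 : ℝ) : ℂ) + t * I) := by
    refine intervalIntegral.integral_congr fun t _ ↦ ?_
    rw [← hper (((0 : ℝ) : ℂ) + t * I)]
    congr 1
    push_cast
    ring
  rw [hvert, add_sub_cancel_right, sub_eq_zero] at h
  rw [← h]
  refine intervalIntegral.integral_congr fun x _ ↦ ?_
  simp

/-- **Vanishing of the high coefficient integrals.** If `Φ` is entire, `π/2`-periodic and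
`‖Φ z‖ ≤ C e^{N |Im z|}`, then `∫₀^{π/2} e^{4imx} Φ x dx = 0` whenever `4|m| > N`: by the contour
shift the integral equals the one at height `y = ±s` (sign of `m`), which is bounded by
`(π/2) C e^{(N - 4|m|) s} → 0` as `s → ∞`. [folklore] -/
theorem integral_twist_eq_zero {Φ : ℂ → ℂ} {C N : ℝ} (hd : Differentiable ℂ Φ)
    (hper : ∀ z : ℂ, Φ (z + (Real.pi / 2 : ℝ)) = Φ z)
    (hbd : ∀ z : ℂ, ‖Φ z‖ ≤ C * Real.exp (N * |z.im|)) {m : ℤ} (hm : N < 4 * |(m : ℝ)|) :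
    ∫ x in (0 : ℝ)..Real.pi / 2, Complex.exp (4 * (m : ℂ) * x * Complex.I) * Φ x = 0 := by
  set F : ℂ → ℂ := fun z ↦ Complex.exp (4 * (m : ℂ) * z * Complex.I) * Φ z with hF
  have hFd : Differentiable ℂ F := by rw [hF]; fun_prop
  have hFper : ∀ z : ℂ, F (z + (Real.pi / 2 : ℝ)) = F z := fun z ↦ twist_periodic hper m z
  -- the coefficient integral may be computed at any height `y`
  have hconst : ∀ y : ℝ, ∫ x in (0 : ℝ)..Real.pi / 2, F (x + y * I) =
      ∫ x in (0 : ℝ)..Real.pi / 2, F x := integral_horizontal_eq_of_periodic hFd hFper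
  -- bound at height `y = ±s`
  have hbound : ∀ s : ℝ, 0 ≤ s → ‖∫ x in (0 : ℝ)..Real.pi / 2, F x‖ ≤
      C * Real.exp ((N - 4 * |(m : ℝ)|) * s) * |Real.pi / 2 - 0| := by
    intro s hs
    obtain ⟨y, hy1, hy2⟩ : ∃ y : ℝ, |y| = s ∧ 4 * (m : ℝ) * y = 4 * |(m : ℝ)| * s := by
      rcases le_or_gt 0 (m : ℝ) with h | h
      · exact ⟨s, abs_of_nonneg hs, by rw [abs_of_nonneg h]⟩
      · exact ⟨-s, by rw [abs_neg, abs_of_nonneg hs], by rw [abs_of_neg h]; ring⟩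
    rw [← hconst y]
    refine intervalIntegral.norm_integral_le_of_norm_le_const fun x _ ↦ ?_
    simp only [hF]
    rw [norm_mul, Complex.norm_exp]
    have hre : (4 * (m : ℂ) * (↑x + ↑y * I) * I).re = -(4 * (m : ℝ) * y) := by
      simp [Complex.mul_re, Complex.mul_im]
    have him : (↑x + ↑y * I : ℂ).im = y := by simp
    have hΦ : ‖Φ (↑x + ↑y * I)‖ ≤ C * Real.exp (N * s) := by
      have := hbd (↑x + ↑y * I)
      rwa [him, hy1] at this
    rw [hre, hy2]
    calc Real.exp (-(4 * |(m : ℝ)| * s)) * ‖Φ (↑x + ↑y * I)‖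
        ≤ Real.exp (-(4 * |(m : ℝ)| * s)) * (C * Real.exp (N * s)) :=
          mul_le_mul_of_nonneg_left hΦ (Real.exp_pos _).le
      _ = C * Real.exp ((N - 4 * |(m : ℝ)|) * s) := by
          rw [show (N - 4 * |(m : ℝ)|) * s = -(4 * |(m : ℝ)| * s) + N * s by ring, Real.exp_add]
          ring
  -- let `s → ∞`
  have hδ : 0 < 4 * |(m : ℝ)| - N := by linarith
  have htend : Tendsto (fun s : ℝ ↦ C * Real.exp ((N - 4 * |(m : ℝ)|) * s) * |Real.pi / 2 - 0|)
      atTop (𝓝 (C * 0 * |Real.pi / 2 - 0|)) := by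
    refine (tendsto_const_nhds.mul ?_).mul tendsto_const_nhds
    have : (fun s : ℝ ↦ Real.exp ((N - 4 * |(m : ℝ)|) * s)) =
        (fun x : ℝ ↦ Real.exp (-x)) ∘ (fun s : ℝ ↦ (4 * |(m : ℝ)| - N) * s) := by
      ext s
      simp only [Function.comp_apply]
      congr 1
      ring
    rw [this]
    exact Real.tendsto_exp_neg_atTop_nhds_zero.comp (tendsto_id.const_mul_atTop hδ)
  rw [mul_zero, zero_mul] at htend
  have hle : ‖∫ x in (0 : ℝ)..Real.pi / 2, F x‖ ≤ 0 :=
    le_of_tendsto_of_tendsto tendsto_const_nhds htend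
      (Filter.eventually_atTop.2 ⟨0, fun s hs ↦ hbound s hs⟩)
  exact norm_le_zero_iff.1 hle

/-! ## Band limitation -/

/-- **Angular Paley–Wiener, master form.** For an entire `π/2`-periodic `Φ` with
`‖Φ z‖ ≤ C e^{N |Im z|}` there is ONE coefficient sequence `c` (the Fourier coefficients
`c_k = (2/π) ∫₀^{π/2} e^{-4ikx} Φ x dx` of the lift of `Φ|ℝ` to `AddCircle (π/2)`) such that
`c_k = 0` whenever `4|k| > N` (`integral_twist_eq_zero`) and, for every cut-off `K` with
`N < 4(K+1)`, `Φ θ = ∑_{|k| ≤ K} c_k e^{4ikθ}` on `ℝ` (the coefficients are supported in `|k| ≤ K`,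
hence summable, and Mathlib's `has_pointwise_sum_fourier_series_of_summable` sums the series
pointwise; the sum is finite by `hasSum_sum_of_ne_finset_zero` and uniqueness of limits). [folklore] -/
theorem bandlimit_main {Φ : ℂ → ℂ} {C N : ℝ} (hd : Differentiable ℂ Φ)
    (hper : ∀ z : ℂ, Φ (z + (Real.pi / 2 : ℝ)) = Φ z)
    (hbd : ∀ z : ℂ, ‖Φ z‖ ≤ C * Real.exp (N * |z.im|)) :
    ∃ c : ℤ → ℂ, (∀ k : ℤ, N < 4 * |(k : ℝ)| → c k = 0) ∧
      ∀ K : ℕ, N < 4 * ((K : ℝ) + 1) → ∀ θ : ℝ,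
        Φ θ = ∑ k ∈ Finset.Icc (-(K : ℤ)) K,
          c k * Complex.exp (4 * (k : ℂ) * (θ : ℂ) * Complex.I) := by
  haveI hT : Fact (0 < Real.pi / 2) := ⟨by positivity⟩
  -- the continuous `π/2`-periodic restriction to `ℝ`, lifted to the circle of length `π/2`
  have hperℝ : Function.Periodic (fun x : ℝ ↦ Φ x) (Real.pi / 2) := fun x ↦ by
    show Φ ((x + Real.pi / 2 : ℝ) : ℂ) = Φ x
    rw [Complex.ofReal_add]
    exact hper x
  let g : C(AddCircle (Real.pi / 2), ℂ) :=
    ⟨hperℝ.lift, continuous_coinduced_dom.mpr (hd.continuous.comp Complex.continuous_ofReal)⟩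
  have hg : ∀ θ : ℝ, g (θ : AddCircle (Real.pi / 2)) = Φ θ := fun θ ↦ rfl
  -- its Fourier coefficients are the twisted integrals with `m = -k`
  have hc : ∀ k : ℤ, fourierCoeff g k = (1 / (Real.pi / 2)) • ∫ x in (0 : ℝ)..Real.pi / 2,
      Complex.exp (4 * ((-k : ℤ) : ℂ) * x * Complex.I) * Φ x := by
    intro k
    rw [fourierCoeff_eq_intervalIntegral g k 0, zero_add]
    congr 1
    refine intervalIntegral.integral_congr fun x _ ↦ ?_
    simp only [smul_eq_mul]
    rw [fourier_quarterCircle_apply, hg]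
  -- the high coefficients vanish
  have hzero : ∀ k : ℤ, N < 4 * |(k : ℝ)| → fourierCoeff g k = 0 := fun k hk ↦ by
    rw [hc, integral_twist_eq_zero hd hper hbd (m := -k) (by rwa [Int.cast_neg, abs_neg]),
      smul_zero]
  refine ⟨fourierCoeff g, hzero, fun K hK θ ↦ ?_⟩
  -- so the coefficients are supported in `|k| ≤ K`
  have hcz : ∀ k ∉ Finset.Icc (-(K : ℤ)) K, fourierCoeff g k = 0 := by
    intro k hk
    refine hzero k ?_
    rw [Finset.mem_Icc, not_and_or, not_le, not_le] at hk
    have h1 : (K : ℤ) < |k| := lt_abs.2 (hk.symm.imp id fun h ↦ by linarith)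
    have h2 : (K : ℤ) + 1 ≤ |k| := h1
    have h3 : (K : ℝ) + 1 ≤ |(k : ℝ)| := by exact_mod_cast h2
    linarith
  -- pointwise Fourier expansion, a finite sum
  have hS : HasSum (fun k : ℤ ↦ fourierCoeff g k • fourier k (θ : AddCircle (Real.pi / 2)))
      (∑ k ∈ Finset.Icc (-(K : ℤ)) K, fourierCoeff g k • fourier k (θ : AddCircle (Real.pi / 2))) :=
    hasSum_sum_of_ne_finset_zero fun k hk ↦ by rw [hcz k hk, zero_smul]
  have hpt := has_pointwise_sum_fourier_series_of_summable (summable_of_ne_finset_zero hcz)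
    (θ : AddCircle (Real.pi / 2))
  rw [hg] at hpt
  rw [hpt.unique hS]
  exact Finset.sum_congr rfl fun k _ ↦ by rw [smul_eq_mul, fourier_quarterCircle_apply]

/-! ## The stub (signature as registered by skeleton `b19344cfca0f`, explicit degree) -/

/-- **Stub `stub_bandlimit` of line `complex-rotation-bandlimit` (angular Paley–Wiener, explicit
degree).** An entire `π/2`-periodic function of exponential type `N` in `Im z` is, on the real axis,
a trigonometric polynomial in `e^{4iθ}` of degree `≤ K` for every `K` with `N < 4(K+1)`: its
restriction to `ℝ` lifts to a continuous function on `AddCircle (π/2)` whose Fourier coefficients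
`c_k = (2/π) ∫₀^{π/2} e^{-4ikx} Φ x dx` vanish for `4|k| > N` (`integral_twist_eq_zero`), hence for
`|k| > K`, so they are finitely supported and summable, and the Fourier series converges pointwise
to `Φ` (Mathlib's `has_pointwise_sum_fourier_series_of_summable`); see `bandlimit_main`. [folklore] -/
theorem stub_bandlimit :
    ∀ (Φ : ℂ → ℂ) (C N : ℝ) (K : ℕ), Differentiable ℂ Φ →
      (∀ z : ℂ, Φ (z + (Real.pi / 2 : ℝ)) = Φ z) →
      (∀ z : ℂ, ‖Φ z‖ ≤ C * Real.exp (N * |z.im|)) →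
      N < 4 * ((K : ℝ) + 1) →
      ∃ c : ℤ → ℂ, ∀ θ : ℝ,
        Φ θ = ∑ k ∈ Finset.Icc (-(K : ℤ)) K, c k * Complex.exp (4 * (k : ℂ) * (θ : ℂ) * Complex.I) := by
  intro Φ C N K hd hper hbd hK
  obtain ⟨c, -, hexp⟩ := bandlimit_main hd hper hbd
  exact ⟨c, hexp K hK⟩

/-- **Existential-degree form with vanishing clause** (the shape of `stub_bandlimit` in the line
lead's reshape r1 of the skeleton): some degree `M` (here `⌈N/4⌉₊`) and ONE coefficient sequence
`c` with `Φ θ = ∑_{|k| ≤ M} c_k e^{4ikθ}` on `ℝ` whose harmonics with `4|k| > N` vanish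
(`bandlimit_main`). [folklore] -/
theorem bandlimit_exists_degree :
    ∀ (Φ : ℂ → ℂ) (C N : ℝ), Differentiable ℂ Φ →
      (∀ z : ℂ, Φ (z + (Real.pi / 2 : ℝ)) = Φ z) →
      (∀ z : ℂ, ‖Φ z‖ ≤ C * Real.exp (N * |z.im|)) →
      ∃ (M : ℕ) (c : ℤ → ℂ),
        (∀ θ : ℝ, Φ θ = ∑ k ∈ Finset.Icc (-(M : ℤ)) M, c k * Complex.exp (4 * (k : ℂ) * (θ : ℂ) * Complex.I)) ∧
        (∀ k : ℤ, N < 4 * |(k : ℝ)| → c k = 0) := by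
  intro Φ C N hd hper hbd
  obtain ⟨c, hzero, hexp⟩ := bandlimit_main hd hper hbd
  refine ⟨⌈N / 4⌉₊, c, hexp _ ?_, hzero⟩
  have := Nat.le_ceil (N / 4)
  linarith

end Summit.QuantumFields.YangMills.Theorems.NPointIsotropy.ComplexRotationBandlimit

end
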